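/-
Copyright: the b2b-balaban T⁴-continuum CRUX team, row NE7b OWNER lineage `t4-ne7b-p1` (gen 128). Project licence.
-/
import Summits.QuantumFields.BalabanUV.T4Continuum.Spine.NE7b.SupFibreGaussianCovariance

/-!
# READING SITE-CELL FACTORS IN THE CHART: for a block-local chart `P` (`(Pe_j)_x = 0` unless the site `x` lies in the home block of the
# index `j`) with the ceiling `Σ_x(Pz)_x² ≤ qΣ_j z_j²`, a factor of the fluctuation FIELD `ζ = Pz` living on the sites of the block `b`
# becomes a factor of the chart coordinates `z` living on the indices homed in `b`: (i) `(Pz)_x = Σ_{j homed in block(x)} z_j(Pe_j)_x`;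
# (ii) `Σ_{x∈block b}(Pz)_x² ≤ q·Σ_{j homed in b} z_j²`; (iii) a factor REGULATED in the field on the block, `‖G(ζ)‖ ≤ ε·e^{½κΣ_{x∈block b}ζ_x²}`,
# is regulated in the chart on the cell, `‖G(Pz)‖ ≤ ε·e^{½κqΣ_{j homed in b}z_j²}`; (iv) a factor MEASURABLE in `ζ|_{block b}` is measurable
# in `z|_{cell b}` — so (289)∕(291)∕(298) apply to the road's field factors with cells = chart indices homed in a block and regulator
# strength `κq` (row NE7b, node U5c; (271)'s `chart_apply` + bookkeeping; [folklore])

Cell `pub-balaban`, sub-cell `t4`, spine estimate NE7b (`T4WeightBudget.RelWeightBound`; the cell's OWN estimate — NOT PRINTED in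
[Bałaban 1983–89], NOT PROVED).  Crux-route work under `Spine/NE7b/` by the row OWNER (`t4-ne7b-p1` gen 128, file (300)) under FREEZE
(0)'s crux-prover clause, on § [NE7bP1-G127-HANDOFF] NEXT (3)(b)∕(d) (the «consumer's reading» left open in (291)∕(298)); NOTHING of Bałaban's
is named as a Lean object, valued or asserted; no `T4Continuum/Support` leaf typed; no `def`, no notation; zero `sorry`.  Imports (BY NAME):
the OWNER's (271) `…SupFibreGaussianCovariance` (`chart_apply`: `(Pz)_x = Σ_j z_j(Pe_j)_x`).

WHY (located).  (291)∕(298) read the regulated polymer gas on the scale pieces of the fluctuation law in CHART coordinates `z` (where the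
Gaussian lives), with cells = sets of chart indices; the road's fluctuation factors are functions of the FIELD `ζ = Pz` on blocks of
sites.  (279)(v)'s block-locality of the chart and (273)'s ceiling make the translation exact and cheap; this file types it, so the
regulated bound of (290) (strength `κ` in `ζ` on a block) becomes the hypothesis of (289)∕(291) (strength `κq` in `z` on the block's cell).

WHAT IS PROVED ([folklore]; `blockOf : ι → β` the block of a site, `home : σ → β` the home block of a chart index, locality
`blockOf x ≠ home j ⟹ (Pe_j)_x = 0`; `cell b = {j | home j = b}`, `block b = {x | blockOf x = b}` as `Finset.univ.filter`):
* §1 `apply_eq_sum_cell` (`(Pz)_x = Σ_{j∈cell(blockOf x)} z_j(Pe_j)_x`), `apply_cutoff_of_mem` ∕ `apply_cutoff_of_not_mem` (cutting `z` off outside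
  `cell b` leaves `(Pz)_x` unchanged on `block b` and kills it elsewhere), **`block_sq_sum_le`** (`Σ_{x∈block b}(Pz)_x² ≤ q·Σ_{j∈cell b}z_j²`);
* §2 **`chart_regulated_of_field_regulated`** (`‖G(ζ)‖ ≤ ε·e^{½κΣ_{x∈block b}ζ_x²}` for all `ζ`, `0 ≤ ε`, `0 ≤ κ` ⟹
  `‖G(Pz)‖ ≤ ε·e^{½(κq)Σ_{j∈cell b}z_j²}` for all `z`, also read on `EuclideanSpace`);
* §3 `blockRestrict_eq_linear` (the restriction of `Pz` to `block b` is a fixed linear function of `z|_{cell b}`),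
  **`chart_measurable_of_field_measurable`** (`G = F ∘ (·|_{block b})` with `F` measurable ⟹ `z ↦ G(Pz)` is `σ(z|_{cell b})`-measurable on
  `EuclideanSpace ℝ σ`); §4 toy.

HONEST (what this is NOT).  Linear-algebra and σ-algebra bookkeeping; the cell sizes (`#cell b ≤ (n+1)^d − 1` for (279)'s chart) and the
disjointness of the cells (automatic: distinct home blocks) are read by the consumer; scalar skeleton ((A3), NC-NE7b-α UNRULED); nothing of
Bałaban's asserted.  BY-NAME EFFECT ON THE WALL: NONE.  NE7b NOT PRINTED ∕ NOT PROVED; spine PROVED 0∕9; rung (B)+1 — the programme's measures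
remain FINITE-torus statements; NOT the mass gap, NOT Clay.  HONEST DEPENDENCY: continuum YM on T⁴ ⇐ BetaPertH ∧ nine spine estimates (0∕9
proved); BetaPertH ⇐ (D1) ∧ (D4) ∧ CAP+tail; G-an2-4 gates asym, D1 and NE2∕3∕4.
-/

set_option autoImplicit false

noncomputable section

namespace Summit.QuantumFields.BalabanUV.T4Continuum.NE7b.SupChartCellReading

open MeasureTheory Finset Real WithLp
open scoped BigOperators
open SupFibreGaussianCovariance (chart_apply)

variable {ι : Type*} [Fintype ι] {σ : Type} [Fintype σ] [DecidableEq σ] {β : Type*} [DecidableEq β]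
  (P : (σ → ℝ) →L[ℝ] (ι → ℝ)) (blockOf : ι → β) (home : σ → β)

/-! ## §1. Block-locality read on the evaluation formula -/

omit [Fintype ι] in
/-- **`(Pz)_x` SEES ONLY THE INDICES HOMED IN THE BLOCK OF `x`**: `(Pz)_x = Σ_{j : home j = blockOf x} z_j(Pe_j)_x`. [folklore] -/
theorem apply_eq_sum_cell (hPloc : ∀ j x, blockOf x ≠ home j → P (Pi.single j 1) x = 0) (z : σ → ℝ) (x : ι) :
    P z x = ∑ j ∈ Finset.univ.filter (fun j => home j = blockOf x), z j * P (Pi.single j 1) x := by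
  rw [chart_apply P z x, ← Finset.sum_filter_add_sum_filter_not Finset.univ (fun j => home j = blockOf x)]
  have h0 : ∑ j ∈ Finset.univ.filter (fun j => ¬ home j = blockOf x), z j * P (Pi.single j 1) x = 0 :=
    Finset.sum_eq_zero fun j hj => by
      rw [hPloc j x (fun h => (Finset.mem_filter.1 hj).2 h.symm), mul_zero]
  rw [h0, add_zero]

omit [Fintype ι] in
/-- Cutting `z` off outside `cell b` leaves `(Pz)_x` unchanged for `x ∈ block b`. [folklore] -/
theorem apply_cutoff_of_mem (hPloc : ∀ j x, blockOf x ≠ home j → P (Pi.single j 1) x = 0) (z : σ → ℝ) (b : β) (x : ι)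
    (hx : blockOf x = b) :
    P (fun j => if home j = b then z j else 0) x = P z x := by
  rw [apply_eq_sum_cell P blockOf home hPloc, apply_eq_sum_cell P blockOf home hPloc]
  refine Finset.sum_congr rfl fun j hj => ?_
  rw [if_pos ((Finset.mem_filter.1 hj).2.trans hx)]

omit [Fintype ι] in
/-- Cutting `z` off outside `cell b` kills `(Pz)_x` for `x ∉ block b`. [folklore] -/
theorem apply_cutoff_of_not_mem (hPloc : ∀ j x, blockOf x ≠ home j → P (Pi.single j 1) x = 0) (z : σ → ℝ) (b : β) (x : ι)
    (hx : blockOf x ≠ b) :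
    P (fun j => if home j = b then z j else 0) x = 0 := by
  rw [apply_eq_sum_cell P blockOf home hPloc]
  refine Finset.sum_eq_zero fun j hj => ?_
  have hjb : home j ≠ b := fun h => hx ((Finset.mem_filter.1 hj).2.symm.trans h)
  rw [if_neg hjb, zero_mul]

/-- **THE FIELD ON A BLOCK IS CONTROLLED BY THE CHART COORDINATES ON ITS CELL**: with the ceiling `Σ_x(Pz)_x² ≤ qΣ_j z_j²`,
`Σ_{x∈block b}(Pz)_x² ≤ q·Σ_{j∈cell b}z_j²`. [folklore] -/
theorem block_sq_sum_le (hPloc : ∀ j x, blockOf x ≠ home j → P (Pi.single j 1) x = 0) {q : ℝ}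
    (hPceil : ∀ z : σ → ℝ, ∑ x, P z x ^ 2 ≤ q * ∑ i, z i ^ 2) (z : σ → ℝ) (b : β) :
    ∑ x ∈ Finset.univ.filter (fun x => blockOf x = b), P z x ^ 2 ≤ q * ∑ j ∈ Finset.univ.filter (fun j => home j = b), z j ^ 2 := by
  set z' : σ → ℝ := fun j => if home j = b then z j else 0 with hz'
  -- on `block b`, `Pz = Pz'`; elsewhere `Pz' = 0`
  have h1 : ∑ x ∈ Finset.univ.filter (fun x => blockOf x = b), P z x ^ 2 = ∑ x, P z' x ^ 2 := by
    rw [← Finset.sum_filter_add_sum_filter_not Finset.univ (fun x => blockOf x = b) (fun x => P z' x ^ 2)]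
    have h0 : ∑ x ∈ Finset.univ.filter (fun x => ¬ blockOf x = b), P z' x ^ 2 = 0 :=
      Finset.sum_eq_zero fun x hx => by
        rw [hz', apply_cutoff_of_not_mem P blockOf home hPloc z b x (Finset.mem_filter.1 hx).2]; ring
    rw [h0, add_zero]
    exact Finset.sum_congr rfl fun x hx => by rw [hz', apply_cutoff_of_mem P blockOf home hPloc z b x (Finset.mem_filter.1 hx).2]
  have h2 : ∑ i, z' i ^ 2 = ∑ j ∈ Finset.univ.filter (fun j => home j = b), z j ^ 2 := by
    rw [← Finset.sum_filter_add_sum_filter_not Finset.univ (fun j => home j = b) (fun j => z' j ^ 2)]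
    have h0 : ∑ j ∈ Finset.univ.filter (fun j => ¬ home j = b), z' j ^ 2 = 0 :=
      Finset.sum_eq_zero fun j hj => by rw [hz']; simp only [(Finset.mem_filter.1 hj).2, if_false]; ring
    rw [h0, add_zero]
    exact Finset.sum_congr rfl fun j hj => by rw [hz']; simp only [(Finset.mem_filter.1 hj).2, if_true]
  rw [h1, ← h2]
  exact hPceil z'

/-! ## §2. Regulated field factors are regulated chart factors -/

/-- **A FACTOR REGULATED IN THE FIELD ON A BLOCK IS REGULATED IN THE CHART ON THE BLOCK'S CELL**: `‖G(ζ)‖ ≤ ε·e^{½κΣ_{x∈block b}ζ_x²}` for all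
`ζ` (`0 ≤ ε`, `0 ≤ κ`), block-local chart with ceiling `q` ⟹ `‖G(Pz)‖ ≤ ε·e^{½(κq)Σ_{j∈cell b}z_j²}` for all `z`. [folklore] -/
theorem chart_regulated_of_field_regulated {E : Type*} [SeminormedAddCommGroup E]
    (hPloc : ∀ j x, blockOf x ≠ home j → P (Pi.single j 1) x = 0) {q : ℝ} (hPceil : ∀ z : σ → ℝ, ∑ x, P z x ^ 2 ≤ q * ∑ i, z i ^ 2)
    {G : (ι → ℝ) → E} {ε κ : ℝ} (hε : 0 ≤ ε) (hκ : 0 ≤ κ) (b : β)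
    (hG : ∀ ζ : ι → ℝ, ‖G ζ‖ ≤ ε * exp (κ * (∑ x ∈ Finset.univ.filter (fun x => blockOf x = b), ζ x ^ 2) / 2)) (z : σ → ℝ) :
    ‖G (P z)‖ ≤ ε * exp (κ * q * (∑ j ∈ Finset.univ.filter (fun j => home j = b), z j ^ 2) / 2) := by
  refine (hG (P z)).trans (mul_le_mul_of_nonneg_left (exp_le_exp.2 ?_) hε)
  have h := mul_le_mul_of_nonneg_left (block_sq_sum_le P blockOf home hPloc hPceil z b) hκ
  nlinarith [h]

/-- The same read on `EuclideanSpace ℝ σ` (the carrier of the chart Gaussian): `‖G(P z)‖ ≤ ε·e^{½(κq)Σ_{j∈cell b}z_j²}`, in the format of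
(289)'s `hreg` with `cell b = {j | home j = b}`. [folklore] -/
theorem chart_regulated_of_field_regulated' {E : Type*} [SeminormedAddCommGroup E]
    (hPloc : ∀ j x, blockOf x ≠ home j → P (Pi.single j 1) x = 0) {q : ℝ} (hPceil : ∀ z : σ → ℝ, ∑ x, P z x ^ 2 ≤ q * ∑ i, z i ^ 2)
    {G : (ι → ℝ) → E} {ε κ : ℝ} (hε : 0 ≤ ε) (hκ : 0 ≤ κ) (b : β)
    (hG : ∀ ζ : ι → ℝ, ‖G ζ‖ ≤ ε * exp (κ * (∑ x ∈ Finset.univ.filter (fun x => blockOf x = b), ζ x ^ 2) / 2))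
    (z : EuclideanSpace ℝ σ) :
    ‖G (P (ofLp z))‖ ≤ ε * exp (κ * q * (∑ j ∈ Finset.univ.filter (fun j => home j = b), z j ^ 2) / 2) :=
  chart_regulated_of_field_regulated P blockOf home hPloc hPceil hε hκ b hG (ofLp z)

/-! ## §3. Field-measurable factors are chart-cell-measurable -/

omit [Fintype ι] in
/-- **THE FIELD ON `block b` IS A FIXED LINEAR FUNCTION OF `z|_{cell b}`**: for `x ∈ block b`,
`(Pz)_x = Σ_{j : cell b} (z|_{cell b})_j (Pe_j)_x`. [folklore] -/
theorem blockRestrict_eq_linear (hPloc : ∀ j x, blockOf x ≠ home j → P (Pi.single j 1) x = 0) (b : β) (z : σ → ℝ)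
    (x : ι) (hx : blockOf x = b) :
    P z x = ∑ j : Finset.univ.filter (fun j => home j = b), z j * P (Pi.single (j : σ) 1) x := by
  rw [apply_eq_sum_cell P blockOf home hPloc z x, hx, ← Finset.sum_coe_sort]

/-- **A FACTOR MEASURABLE IN THE FIELD ON A BLOCK IS MEASURABLE IN THE CHART ON THE BLOCK'S CELL**: if `G(ζ) = F(ζ|_{block b})` with `F`
measurable, then `z ↦ G(Pz)` is measurable for `σ(z|_{cell b})` on `EuclideanSpace ℝ σ` — the `hmeas` of (289) with `cell b = {j | home j = b}`.
[folklore] -/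
theorem chart_measurable_of_field_measurable {E : Type*} [MeasurableSpace E]
    (hPloc : ∀ j x, blockOf x ≠ home j → P (Pi.single j 1) x = 0) (b : β)
    {F : (Finset.univ.filter (fun x : ι => blockOf x = b) → ℝ) → E} (hF : Measurable F) :
    Measurable[MeasurableSpace.comap (fun (z : EuclideanSpace ℝ σ) (j : Finset.univ.filter (fun j => home j = b)) => z j) inferInstance]
      (fun z : EuclideanSpace ℝ σ => F (fun x => P (ofLp z) x)) := by
  -- the linear reading `L f x = Σ_j f_j (Pe_j)_x` on the cell coordinates
  set L : (Finset.univ.filter (fun j : σ => home j = b) → ℝ) → (Finset.univ.filter (fun x : ι => blockOf x = b) → ℝ) :=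
    fun f x => ∑ j, f j * P (Pi.single (j : σ) 1) x with hL
  have hLm : Measurable L := by
    refine measurable_pi_lambda _ fun x => Finset.measurable_sum _ fun j _ => ?_
    exact (measurable_pi_apply j).mul_const _
  have hfun : (fun z : EuclideanSpace ℝ σ => F (fun x => P (ofLp z) x)) =
      F ∘ L ∘ (fun (z : EuclideanSpace ℝ σ) (j : Finset.univ.filter (fun j => home j = b)) => z j) := by
    funext z
    simp only [Function.comp_apply, hL]
    congr 1
    funext x
    exact blockRestrict_eq_linear P blockOf home hPloc b (ofLp z) x (Finset.mem_filter.1 x.2).2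
  rw [hfun]
  exact hF.comp (hLm.comp (Measurable.of_comap_le le_rfl))

/-! ## §4. Toy -/

/-- Toy (§1 with the identity chart on `Fin 2`, every site its own block, `q = 1`): `Σ_{x∈block b}(z)_x² ≤ 1·Σ_{j∈cell b}z_j²`. -/
example (z : Fin 2 → ℝ) (b : Fin 2) :
    ∑ x ∈ Finset.univ.filter (fun x : Fin 2 => x = b), (ContinuousLinearMap.id ℝ (Fin 2 → ℝ)) z x ^ 2 ≤
      1 * ∑ j ∈ Finset.univ.filter (fun j : Fin 2 => j = b), z j ^ 2 :=
  block_sq_sum_le (ContinuousLinearMap.id ℝ (Fin 2 → ℝ)) id id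
    (fun j x hjx => by rw [ContinuousLinearMap.id_apply]; exact Pi.single_eq_of_ne hjx _) (fun z => by simp) z b

end Summit.QuantumFields.BalabanUV.T4Continuum.NE7b.SupChartCellReading
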